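import Summits.SmoothPoincare4.SmoothPoincare4.Theses.SymplecticOrigami
import Summits.SmoothPoincare4.SmoothPoincare4.Theses.SymplecticCap
import Summits.SmoothPoincare4.SmoothPoincare4.Theorems.SymplecticOrigamiGromovRecognitionRelEndStubEndDoesNotReturn
import Summits.SmoothPoincare4.SmoothPoincare4.Theorems.SymplecticOrigamiGromovRecognitionRelEndStubTameJ
import Summits.SmoothPoincare4.SmoothPoincare4.Theorems.SymplecticOrigamiGromovRecognitionRelEndStubCapModel
import Summits.SmoothPoincare4.SmoothPoincare4.Theorems.SymplecticOrigamiGromovRecognitionRelEndStubFlatCutoff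
import Summits.SmoothPoincare4.SmoothPoincare4.Theorems.SymplecticOrigamiGromovRecognitionRelEndStubTameMoser
import Literature.Geometry.Symplectic.AlmostComplexStructure
import Literature.Geometry.Symplectic.GromovR4RelEnd

/-!
# Reduction of the crux `GromovRecognitionRelEnd` to the Gromov–McDuff bi-foliation of the wedge cap
(line `cross-cap-laurent`, item stmt-SmoothPoincare4-11009; lead prover file)

The crux — Gromov's recognition of `(ℝ⁴, ω₀)` relative at infinity, McDuff–Salamon 2017
Rem. 4.5.2 (viii), = `Literature.Geometry.Symplectic.gromov_recognitionR4_relEnd` = both route decls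
`SymplecticCap.GromovRecognitionRelEnd` / `SymplecticOrigami.GromovRecognitionRelEnd` (`Iff.rfl`) —
follows from the six registered stubs of the line skeleton
`Cruxes/GromovRecognitionRelEnd/Lines/cross_cap_laurent.lean`. Five of them are THEOREMS of the tree
(`stub_endDoesNotReturn`, `stub_tameJ`, `stub_capModel`, `stub_flatCutoff`, `stub_tameMoser`, files
`Theorems/SymplecticOrigamiGromovRecognitionRelEndStub*.lean`); the sixth, the APEX `stub_biFoliation`
(the two `J`-sphere fibrations of the wedge cap read on `M`: Wendl 2018 Thm 6.8 made relative and
non-generic, McDuff–Salamon 2017 Rem. 4.5.2 (v), Gromov 1985 §0.3.C/2.4.A₁) is the entire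
`J`-holomorphic-curve content of Gromov's theorem and is not proved here.

This file records the reduction KERNEL-CHECKED and sorry-free, with NO definition: the hypothesis
`hB` of `GromovRecognitionRelEnd_of_biFoliation` is VERBATIM the registered stub signature of the
apex (skeleton ll. 336–413), and the proof is the skeleton's composition with the five landed stubs
inlined (`helper_reductionToBiFoliation` is the arrow form registered as a helper sub-goal of the
item; `gromov_recognitionR4_relEnd_of_biFoliation` reaches the Literature constant). So the day the
apex is proved — or vendored as a named fact and discharged — the crux closes by one application.
The apex is NOT a restatement of the crux: its conclusion is a bi-foliation chart with two
inequalities and an asymptotic normal form at the spheres at infinity, not a symplectomorphism, and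
`σ ≠ ψ` on the slabs in general (line card, Transfer section).
-/

noncomputable section

-- the prescribed namespace `Summit.<P>.<Sub>.…` duplicates `SmoothPoincare4` (P = Sub)
set_option linter.dupNamespace false

open scoped Manifold ContDiff Topology
open Set TopologicalSpace Literature.Geometry.Kaehler Literature.Geometry.Symplectic

namespace Summit.SmoothPoincare4.SmoothPoincare4.Theorems.GromovRecognitionRelEnd.CrossCapLaurent

/-- Model space `ℝ⁴ = ℂ²` (coordinates `0,1` = `z₁`, `2,3` = `z₂`). -/
local notation "E4" => EuclideanSpace ℝ (Fin 4)
/-- `ℝ² = ℂ`, the coordinate plane of one factor. -/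
local notation "E2" => EuclideanSpace ℝ (Fin 2)

/-- **The crux reduces to the apex.** The skeleton composition of line `cross-cap-laurent` with the
five landed stubs inlined: Stub 1 (end does not return) → Stub 2 (tame `J`, integrable on a sub-end,
`R₁ > max R 0`) → Stub 3 (wedge cap `X`) → APEX `hB` (bi-foliation chart `σ`, the only use of
`π₂(M) = 0`) → Stub 5 (decay + tame cut-off `Φ₁ = ψ` off a compact `K₁ ⊇ K`) → Stub 6 (compactly
supported tame Moser) = the crux's conclusion. [cite: McDuffSalamon2017, Rem. 4.5.2 (viii)] -/
theorem GromovRecognitionRelEnd_of_biFoliation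
    (hB :
      ∀ (M : Type) [TopologicalSpace M] [T2Space M] [SecondCountableTopology M]
        [ChartedSpace E4 M] [IsManifold (𝓡 4) ∞ M] [ConnectedSpace M]
        (J : AlmostComplexStructure (𝓡 4) ∞ M) (K : Set M) (R R₁ : ℝ) (ψ : M → E4) (χ : E4 → M),
        (∀ x : M, Subsingleton (π_ 2 M x)) →
        ContMDiffOn (𝓡 4) 𝓘(ℝ, E4) ∞ ψ Kᶜ →
        ContMDiffOn 𝓘(ℝ, E4) (𝓡 4) ∞ χ (Metric.closedBall (0 : E4) R)ᶜ →
        Set.BijOn ψ Kᶜ (Metric.closedBall (0 : E4) R)ᶜ →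
        (∀ x, x ∈ Kᶜ → χ (ψ x) = x) →
        R < R₁ → 0 < R₁ →
        (∀ x, x ∈ Kᶜ → R₁ < ‖ψ x‖ → ∀ (v : TangentSpace (𝓡 4) x) (a : E4),
            a = mfderiv (𝓡 4) 𝓘(ℝ, E4) ψ x v →
            mfderiv (𝓡 4) 𝓘(ℝ, E4) ψ x (J x v) = WithLp.toLp 2 ![-(a 1), a 0, -(a 3), a 2]) →
        ∀ (X : Type) [TopologicalSpace X] [T2Space X] [SecondCountableTopology X] [CompactSpace X]
          [ConnectedSpace X] [ChartedSpace E4 X] [IsManifold (𝓡 4) ∞ X]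
          (ωX : MForm (𝓡 4) X ℝ 2) (JX : AlmostComplexStructure (𝓡 4) ∞ X) (ι : M → X)
          (ηH ηV ηC : E4 → X),
          (IsSmoothForm ωX ∧ IsClosedForm ωX ∧ JX.IsTamedBy ωX) ∧
          (IsLocalDiffeomorph (𝓡 4) (𝓡 4) ∞ ι ∧ Function.Injective ι ∧
            ∀ (x : M) (v : TangentSpace (𝓡 4) x),
              JX (ι x) (mfderiv (𝓡 4) (𝓡 4) ι x v) = mfderiv (𝓡 4) (𝓡 4) ι x (J x v)) ∧
          (IsLocalDiffeomorphOn 𝓘(ℝ, E4) (𝓡 4) ∞ ηV {p : E4 | p 0 ^ 2 + p 1 ^ 2 < R₁⁻¹ ^ 2} ∧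
            Set.InjOn ηV {p : E4 | p 0 ^ 2 + p 1 ^ 2 < R₁⁻¹ ^ 2} ∧
            (∀ p : E4, p 0 ^ 2 + p 1 ^ 2 < R₁⁻¹ ^ 2 → (p 0 ≠ 0 ∨ p 1 ≠ 0) →
              ηV p = ι (χ (WithLp.toLp 2
                ![p 0 / (p 0 ^ 2 + p 1 ^ 2), -(p 1) / (p 0 ^ 2 + p 1 ^ 2), p 2, p 3]))) ∧
            (∀ p : E4, p 0 = 0 → p 1 = 0 → ηV p ∉ Set.range ι) ∧
            (∀ p : E4, p 0 ^ 2 + p 1 ^ 2 < R₁⁻¹ ^ 2 → ∀ q : E4,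
              JX (ηV p) (mfderiv 𝓘(ℝ, E4) (𝓡 4) ηV p q) =
                mfderiv 𝓘(ℝ, E4) (𝓡 4) ηV p (WithLp.toLp 2 ![-(q 1), q 0, -(q 3), q 2]))) ∧
          (IsLocalDiffeomorphOn 𝓘(ℝ, E4) (𝓡 4) ∞ ηH {p : E4 | p 2 ^ 2 + p 3 ^ 2 < R₁⁻¹ ^ 2} ∧
            Set.InjOn ηH {p : E4 | p 2 ^ 2 + p 3 ^ 2 < R₁⁻¹ ^ 2} ∧
            (∀ p : E4, p 2 ^ 2 + p 3 ^ 2 < R₁⁻¹ ^ 2 → (p 2 ≠ 0 ∨ p 3 ≠ 0) →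
              ηH p = ι (χ (WithLp.toLp 2
                ![p 0, p 1, p 2 / (p 2 ^ 2 + p 3 ^ 2), -(p 3) / (p 2 ^ 2 + p 3 ^ 2)]))) ∧
            (∀ p : E4, p 2 = 0 → p 3 = 0 → ηH p ∉ Set.range ι) ∧
            (∀ p : E4, p 2 ^ 2 + p 3 ^ 2 < R₁⁻¹ ^ 2 → ∀ q : E4,
              JX (ηH p) (mfderiv 𝓘(ℝ, E4) (𝓡 4) ηH p q) =
                mfderiv 𝓘(ℝ, E4) (𝓡 4) ηH p (WithLp.toLp 2 ![-(q 1), q 0, -(q 3), q 2]))) ∧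
          (IsLocalDiffeomorphOn 𝓘(ℝ, E4) (𝓡 4) ∞ ηC
              {p : E4 | p 0 ^ 2 + p 1 ^ 2 < R₁⁻¹ ^ 2 ∧ p 2 ^ 2 + p 3 ^ 2 < R₁⁻¹ ^ 2} ∧
            Set.InjOn ηC {p : E4 | p 0 ^ 2 + p 1 ^ 2 < R₁⁻¹ ^ 2 ∧ p 2 ^ 2 + p 3 ^ 2 < R₁⁻¹ ^ 2} ∧
            (∀ p : E4, p 0 ^ 2 + p 1 ^ 2 < R₁⁻¹ ^ 2 → p 2 ^ 2 + p 3 ^ 2 < R₁⁻¹ ^ 2 →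
              (p 2 ≠ 0 ∨ p 3 ≠ 0) →
              ηC p = ηV (WithLp.toLp 2
                ![p 0, p 1, p 2 / (p 2 ^ 2 + p 3 ^ 2), -(p 3) / (p 2 ^ 2 + p 3 ^ 2)])) ∧
            (∀ p : E4, p 0 ^ 2 + p 1 ^ 2 < R₁⁻¹ ^ 2 → p 2 ^ 2 + p 3 ^ 2 < R₁⁻¹ ^ 2 →
              (p 0 ≠ 0 ∨ p 1 ≠ 0) →
              ηC p = ηH (WithLp.toLp 2
                ![p 0 / (p 0 ^ 2 + p 1 ^ 2), -(p 1) / (p 0 ^ 2 + p 1 ^ 2), p 2, p 3])) ∧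
            ηC 0 ∉ Set.range ι ∧
            (∀ p : E4, p 0 ^ 2 + p 1 ^ 2 < R₁⁻¹ ^ 2 → p 2 ^ 2 + p 3 ^ 2 < R₁⁻¹ ^ 2 → ∀ q : E4,
              JX (ηC p) (mfderiv 𝓘(ℝ, E4) (𝓡 4) ηC p q) =
                mfderiv 𝓘(ℝ, E4) (𝓡 4) ηC p (WithLp.toLp 2 ![-(q 1), q 0, -(q 3), q 2]))) ∧
          (∀ y : X, y ∈ Set.range ι ∨ (∃ p : E4, p 0 ^ 2 + p 1 ^ 2 < R₁⁻¹ ^ 2 ∧ ηV p = y) ∨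
            (∃ p : E4, p 2 ^ 2 + p 3 ^ 2 < R₁⁻¹ ^ 2 ∧ ηH p = y) ∨
            (∃ p : E4, (p 0 ^ 2 + p 1 ^ 2 < R₁⁻¹ ^ 2 ∧ p 2 ^ 2 + p 3 ^ 2 < R₁⁻¹ ^ 2) ∧ ηC p = y)) →
          ∃ σ : M ≃ₘ⟮𝓡 4, 𝓡 4⟯ E4,
            (∀ (x : M) (v : TangentSpace (𝓡 4) x) (a b : E4), a = mfderiv (𝓡 4) 𝓘(ℝ, E4) σ x v →
                b = mfderiv (𝓡 4) 𝓘(ℝ, E4) σ x (J x v) →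
                (a 2 = 0 → a 3 = 0 → b 2 = 0 ∧ b 3 = 0) ∧ (a 0 = 0 → a 1 = 0 → b 0 = 0 ∧ b 1 = 0)) ∧
            (∀ (x : M) (v : TangentSpace (𝓡 4) x), v ≠ 0 →
                0 < stdSymplecticForm (mfderiv (𝓡 4) 𝓘(ℝ, E4) σ x v)
                  (mfderiv (𝓡 4) 𝓘(ℝ, E4) σ x (J x v))) ∧
            (∀ w : E4, R₁ ^ 2 < w 0 ^ 2 + w 1 ^ 2 → (σ (χ w)) 0 = w 0 ∧ (σ (χ w)) 1 = w 1) ∧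
            (∀ w : E4, R₁ ^ 2 < w 2 ^ 2 + w 3 ^ 2 → (σ (χ w)) 2 = w 2 ∧ (σ (χ w)) 3 = w 3) ∧
            (∃ g : E4 → E2, ContDiffOn ℝ ∞ g {p : E4 | p 0 ^ 2 + p 1 ^ 2 < R₁⁻¹ ^ 2} ∧
              (∀ p q : E4, p 0 ^ 2 + p 1 ^ 2 < R₁⁻¹ ^ 2 → (p 0 ≠ 0 ∨ p 1 ≠ 0) →
                q = σ (χ (WithLp.toLp 2
                  ![p 0 / (p 0 ^ 2 + p 1 ^ 2), -(p 1) / (p 0 ^ 2 + p 1 ^ 2), p 2, p 3])) →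
                g p = WithLp.toLp 2 ![q 2, q 3]) ∧
              (∀ p : E4, p 0 = 0 → p 1 = 0 → g p = WithLp.toLp 2 ![p 2, p 3])) ∧
            (∃ h : E4 → E2, ContDiffOn ℝ ∞ h {p : E4 | p 2 ^ 2 + p 3 ^ 2 < R₁⁻¹ ^ 2} ∧
              (∀ p q : E4, p 2 ^ 2 + p 3 ^ 2 < R₁⁻¹ ^ 2 → (p 2 ≠ 0 ∨ p 3 ≠ 0) →
                q = σ (χ (WithLp.toLp 2
                  ![p 0, p 1, p 2 / (p 2 ^ 2 + p 3 ^ 2), -(p 3) / (p 2 ^ 2 + p 3 ^ 2)])) →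
                h p = WithLp.toLp 2 ![q 0, q 1]) ∧
              (∀ p : E4, p 2 = 0 → p 3 = 0 → h p = WithLp.toLp 2 ![p 0, p 1]))) :
    Summit.SmoothPoincare4.SmoothPoincare4.Theses.SymplecticCap.GromovRecognitionRelEnd := by
  intro M _ _ _ _ _ _ sf K R ψ χ h1 h2 h3 h4 h5 h6 h7 h8 h9 h10
  -- Stub 1: the truncations are open
  have hopen : ∀ R', R < R' → IsOpen (K ∪ {x | x ∈ Kᶜ ∧ ‖ψ x‖ < R'}) :=
    stub_endDoesNotReturn M sf K R ψ χ h2 h5 h6 h7 h8 h9 h10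
  -- Stub 2: a tame `J`, integrable beyond `R₁`
  obtain ⟨R₁, J, hR₁, hR₁pos, hJt, hJstd⟩ := stub_tameJ M sf K R ψ h2 h4 h5 h6 h8 h10 hopen
  -- Stub 3: the wedge cap
  obtain ⟨X, _, _, _, _, _, _, _, ωX, JX, ι, ηH, ηV, ηC, hW⟩ :=
    stub_capModel M sf K R ψ χ h2 h3 h4 h5 h6 h7 h8 h9 h10 hopen R₁ J hR₁ hR₁pos hJt hJstd
  -- Stub 4 (apex): the bi-foliation chart
  obtain ⟨σ, hB1, hB2, hB3a, hB3b, hB4, hB5⟩ :=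
    hB M J K R R₁ ψ χ h1 h6 h7 h8 h9 hR₁ hR₁pos hJstd X ωX JX ι ηH ηV ηC hW
  -- Stub 5: decay + tame cut-off
  obtain ⟨Φ₁, K₁, hK₁, hKK₁, hΦψ, htame⟩ :=
    stub_flatCutoff M sf K R ψ χ h5 h6 h7 h8 h9 h10 R₁ J hR₁ hR₁pos hJt hJstd σ
      hB1 hB2 hB3a hB3b hB4 hB5
  -- Stub 6: compactly supported tame Moser
  exact stub_tameMoser M sf J K₁ ψ Φ₁ h2 h3 hK₁ hΦψ
    (fun x hx v w => h10 x (fun hxK => hx (hKK₁ hxK)) v w) hJt htame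

/-- **Registered helper sub-goal `helper_reductionToBiFoliation`** (item stmt-SmoothPoincare4-11009,
line `cross-cap-laurent`): the crux `SymplecticCap.GromovRecognitionRelEnd` follows from the apex
`stub_biFoliation` stated verbatim as the antecedent — arrow form of
`GromovRecognitionRelEnd_of_biFoliation`. [cite: McDuffSalamon2017, Rem. 4.5.2 (viii)] -/
theorem helper_reductionToBiFoliation :
    (∀ (M : Type) [TopologicalSpace M] [T2Space M] [SecondCountableTopology M]
        [ChartedSpace E4 M] [IsManifold (𝓡 4) ∞ M] [ConnectedSpace M]
        (J : AlmostComplexStructure (𝓡 4) ∞ M) (K : Set M) (R R₁ : ℝ) (ψ : M → E4) (χ : E4 → M),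
        (∀ x : M, Subsingleton (π_ 2 M x)) →
        ContMDiffOn (𝓡 4) 𝓘(ℝ, E4) ∞ ψ Kᶜ →
        ContMDiffOn 𝓘(ℝ, E4) (𝓡 4) ∞ χ (Metric.closedBall (0 : E4) R)ᶜ →
        Set.BijOn ψ Kᶜ (Metric.closedBall (0 : E4) R)ᶜ →
        (∀ x, x ∈ Kᶜ → χ (ψ x) = x) →
        R < R₁ → 0 < R₁ →
        (∀ x, x ∈ Kᶜ → R₁ < ‖ψ x‖ → ∀ (v : TangentSpace (𝓡 4) x) (a : E4),
            a = mfderiv (𝓡 4) 𝓘(ℝ, E4) ψ x v →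
            mfderiv (𝓡 4) 𝓘(ℝ, E4) ψ x (J x v) = WithLp.toLp 2 ![-(a 1), a 0, -(a 3), a 2]) →
        ∀ (X : Type) [TopologicalSpace X] [T2Space X] [SecondCountableTopology X] [CompactSpace X]
          [ConnectedSpace X] [ChartedSpace E4 X] [IsManifold (𝓡 4) ∞ X]
          (ωX : MForm (𝓡 4) X ℝ 2) (JX : AlmostComplexStructure (𝓡 4) ∞ X) (ι : M → X)
          (ηH ηV ηC : E4 → X),
          (IsSmoothForm ωX ∧ IsClosedForm ωX ∧ JX.IsTamedBy ωX) ∧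
          (IsLocalDiffeomorph (𝓡 4) (𝓡 4) ∞ ι ∧ Function.Injective ι ∧
            ∀ (x : M) (v : TangentSpace (𝓡 4) x),
              JX (ι x) (mfderiv (𝓡 4) (𝓡 4) ι x v) = mfderiv (𝓡 4) (𝓡 4) ι x (J x v)) ∧
          (IsLocalDiffeomorphOn 𝓘(ℝ, E4) (𝓡 4) ∞ ηV {p : E4 | p 0 ^ 2 + p 1 ^ 2 < R₁⁻¹ ^ 2} ∧
            Set.InjOn ηV {p : E4 | p 0 ^ 2 + p 1 ^ 2 < R₁⁻¹ ^ 2} ∧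
            (∀ p : E4, p 0 ^ 2 + p 1 ^ 2 < R₁⁻¹ ^ 2 → (p 0 ≠ 0 ∨ p 1 ≠ 0) →
              ηV p = ι (χ (WithLp.toLp 2
                ![p 0 / (p 0 ^ 2 + p 1 ^ 2), -(p 1) / (p 0 ^ 2 + p 1 ^ 2), p 2, p 3]))) ∧
            (∀ p : E4, p 0 = 0 → p 1 = 0 → ηV p ∉ Set.range ι) ∧
            (∀ p : E4, p 0 ^ 2 + p 1 ^ 2 < R₁⁻¹ ^ 2 → ∀ q : E4,
              JX (ηV p) (mfderiv 𝓘(ℝ, E4) (𝓡 4) ηV p q) =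
                mfderiv 𝓘(ℝ, E4) (𝓡 4) ηV p (WithLp.toLp 2 ![-(q 1), q 0, -(q 3), q 2]))) ∧
          (IsLocalDiffeomorphOn 𝓘(ℝ, E4) (𝓡 4) ∞ ηH {p : E4 | p 2 ^ 2 + p 3 ^ 2 < R₁⁻¹ ^ 2} ∧
            Set.InjOn ηH {p : E4 | p 2 ^ 2 + p 3 ^ 2 < R₁⁻¹ ^ 2} ∧
            (∀ p : E4, p 2 ^ 2 + p 3 ^ 2 < R₁⁻¹ ^ 2 → (p 2 ≠ 0 ∨ p 3 ≠ 0) →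
              ηH p = ι (χ (WithLp.toLp 2
                ![p 0, p 1, p 2 / (p 2 ^ 2 + p 3 ^ 2), -(p 3) / (p 2 ^ 2 + p 3 ^ 2)]))) ∧
            (∀ p : E4, p 2 = 0 → p 3 = 0 → ηH p ∉ Set.range ι) ∧
            (∀ p : E4, p 2 ^ 2 + p 3 ^ 2 < R₁⁻¹ ^ 2 → ∀ q : E4,
              JX (ηH p) (mfderiv 𝓘(ℝ, E4) (𝓡 4) ηH p q) =
                mfderiv 𝓘(ℝ, E4) (𝓡 4) ηH p (WithLp.toLp 2 ![-(q 1), q 0, -(q 3), q 2]))) ∧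
          (IsLocalDiffeomorphOn 𝓘(ℝ, E4) (𝓡 4) ∞ ηC
              {p : E4 | p 0 ^ 2 + p 1 ^ 2 < R₁⁻¹ ^ 2 ∧ p 2 ^ 2 + p 3 ^ 2 < R₁⁻¹ ^ 2} ∧
            Set.InjOn ηC {p : E4 | p 0 ^ 2 + p 1 ^ 2 < R₁⁻¹ ^ 2 ∧ p 2 ^ 2 + p 3 ^ 2 < R₁⁻¹ ^ 2} ∧
            (∀ p : E4, p 0 ^ 2 + p 1 ^ 2 < R₁⁻¹ ^ 2 → p 2 ^ 2 + p 3 ^ 2 < R₁⁻¹ ^ 2 →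
              (p 2 ≠ 0 ∨ p 3 ≠ 0) →
              ηC p = ηV (WithLp.toLp 2
                ![p 0, p 1, p 2 / (p 2 ^ 2 + p 3 ^ 2), -(p 3) / (p 2 ^ 2 + p 3 ^ 2)])) ∧
            (∀ p : E4, p 0 ^ 2 + p 1 ^ 2 < R₁⁻¹ ^ 2 → p 2 ^ 2 + p 3 ^ 2 < R₁⁻¹ ^ 2 →
              (p 0 ≠ 0 ∨ p 1 ≠ 0) →
              ηC p = ηH (WithLp.toLp 2
                ![p 0 / (p 0 ^ 2 + p 1 ^ 2), -(p 1) / (p 0 ^ 2 + p 1 ^ 2), p 2, p 3])) ∧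
            ηC 0 ∉ Set.range ι ∧
            (∀ p : E4, p 0 ^ 2 + p 1 ^ 2 < R₁⁻¹ ^ 2 → p 2 ^ 2 + p 3 ^ 2 < R₁⁻¹ ^ 2 → ∀ q : E4,
              JX (ηC p) (mfderiv 𝓘(ℝ, E4) (𝓡 4) ηC p q) =
                mfderiv 𝓘(ℝ, E4) (𝓡 4) ηC p (WithLp.toLp 2 ![-(q 1), q 0, -(q 3), q 2]))) ∧
          (∀ y : X, y ∈ Set.range ι ∨ (∃ p : E4, p 0 ^ 2 + p 1 ^ 2 < R₁⁻¹ ^ 2 ∧ ηV p = y) ∨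
            (∃ p : E4, p 2 ^ 2 + p 3 ^ 2 < R₁⁻¹ ^ 2 ∧ ηH p = y) ∨
            (∃ p : E4, (p 0 ^ 2 + p 1 ^ 2 < R₁⁻¹ ^ 2 ∧ p 2 ^ 2 + p 3 ^ 2 < R₁⁻¹ ^ 2) ∧ ηC p = y)) →
          ∃ σ : M ≃ₘ⟮𝓡 4, 𝓡 4⟯ E4,
            (∀ (x : M) (v : TangentSpace (𝓡 4) x) (a b : E4), a = mfderiv (𝓡 4) 𝓘(ℝ, E4) σ x v →
                b = mfderiv (𝓡 4) 𝓘(ℝ, E4) σ x (J x v) →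
                (a 2 = 0 → a 3 = 0 → b 2 = 0 ∧ b 3 = 0) ∧ (a 0 = 0 → a 1 = 0 → b 0 = 0 ∧ b 1 = 0)) ∧
            (∀ (x : M) (v : TangentSpace (𝓡 4) x), v ≠ 0 →
                0 < stdSymplecticForm (mfderiv (𝓡 4) 𝓘(ℝ, E4) σ x v)
                  (mfderiv (𝓡 4) 𝓘(ℝ, E4) σ x (J x v))) ∧
            (∀ w : E4, R₁ ^ 2 < w 0 ^ 2 + w 1 ^ 2 → (σ (χ w)) 0 = w 0 ∧ (σ (χ w)) 1 = w 1) ∧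
            (∀ w : E4, R₁ ^ 2 < w 2 ^ 2 + w 3 ^ 2 → (σ (χ w)) 2 = w 2 ∧ (σ (χ w)) 3 = w 3) ∧
            (∃ g : E4 → E2, ContDiffOn ℝ ∞ g {p : E4 | p 0 ^ 2 + p 1 ^ 2 < R₁⁻¹ ^ 2} ∧
              (∀ p q : E4, p 0 ^ 2 + p 1 ^ 2 < R₁⁻¹ ^ 2 → (p 0 ≠ 0 ∨ p 1 ≠ 0) →
                q = σ (χ (WithLp.toLp 2
                  ![p 0 / (p 0 ^ 2 + p 1 ^ 2), -(p 1) / (p 0 ^ 2 + p 1 ^ 2), p 2, p 3])) →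
                g p = WithLp.toLp 2 ![q 2, q 3]) ∧
              (∀ p : E4, p 0 = 0 → p 1 = 0 → g p = WithLp.toLp 2 ![p 2, p 3])) ∧
            (∃ h : E4 → E2, ContDiffOn ℝ ∞ h {p : E4 | p 2 ^ 2 + p 3 ^ 2 < R₁⁻¹ ^ 2} ∧
              (∀ p q : E4, p 2 ^ 2 + p 3 ^ 2 < R₁⁻¹ ^ 2 → (p 2 ≠ 0 ∨ p 3 ≠ 0) →
                q = σ (χ (WithLp.toLp 2
                  ![p 0, p 1, p 2 / (p 2 ^ 2 + p 3 ^ 2), -(p 3) / (p 2 ^ 2 + p 3 ^ 2)])) →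
                h p = WithLp.toLp 2 ![q 0, q 1]) ∧
              (∀ p : E4, p 2 = 0 → p 3 = 0 → h p = WithLp.toLp 2 ![p 0, p 1]))) →
    Summit.SmoothPoincare4.SmoothPoincare4.Theses.SymplecticCap.GromovRecognitionRelEnd :=
  fun hB => GromovRecognitionRelEnd_of_biFoliation hB

/-- The same reduction reaches the Literature named fact `gromov_recognitionR4_relEnd` (both route
copies of the crux are this constant, `Iff.rfl`; the SymplecticOrigami copy
`Summit.SmoothPoincare4.SmoothPoincare4.Theses.SymplecticOrigami.GromovRecognitionRelEnd` is the
same term by `Iff.rfl` as well). [cite: McDuffSalamon2017, Rem. 4.5.2 (viii)] -/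
theorem gromov_recognitionR4_relEnd_of_biFoliation :
    (∀ (M : Type) [TopologicalSpace M] [T2Space M] [SecondCountableTopology M]
        [ChartedSpace E4 M] [IsManifold (𝓡 4) ∞ M] [ConnectedSpace M]
        (J : AlmostComplexStructure (𝓡 4) ∞ M) (K : Set M) (R R₁ : ℝ) (ψ : M → E4) (χ : E4 → M),
        (∀ x : M, Subsingleton (π_ 2 M x)) →
        ContMDiffOn (𝓡 4) 𝓘(ℝ, E4) ∞ ψ Kᶜ →
        ContMDiffOn 𝓘(ℝ, E4) (𝓡 4) ∞ χ (Metric.closedBall (0 : E4) R)ᶜ →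
        Set.BijOn ψ Kᶜ (Metric.closedBall (0 : E4) R)ᶜ →
        (∀ x, x ∈ Kᶜ → χ (ψ x) = x) →
        R < R₁ → 0 < R₁ →
        (∀ x, x ∈ Kᶜ → R₁ < ‖ψ x‖ → ∀ (v : TangentSpace (𝓡 4) x) (a : E4),
            a = mfderiv (𝓡 4) 𝓘(ℝ, E4) ψ x v →
            mfderiv (𝓡 4) 𝓘(ℝ, E4) ψ x (J x v) = WithLp.toLp 2 ![-(a 1), a 0, -(a 3), a 2]) →
        ∀ (X : Type) [TopologicalSpace X] [T2Space X] [SecondCountableTopology X] [CompactSpace X]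
          [ConnectedSpace X] [ChartedSpace E4 X] [IsManifold (𝓡 4) ∞ X]
          (ωX : MForm (𝓡 4) X ℝ 2) (JX : AlmostComplexStructure (𝓡 4) ∞ X) (ι : M → X)
          (ηH ηV ηC : E4 → X),
          (IsSmoothForm ωX ∧ IsClosedForm ωX ∧ JX.IsTamedBy ωX) ∧
          (IsLocalDiffeomorph (𝓡 4) (𝓡 4) ∞ ι ∧ Function.Injective ι ∧
            ∀ (x : M) (v : TangentSpace (𝓡 4) x),
              JX (ι x) (mfderiv (𝓡 4) (𝓡 4) ι x v) = mfderiv (𝓡 4) (𝓡 4) ι x (J x v)) ∧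
          (IsLocalDiffeomorphOn 𝓘(ℝ, E4) (𝓡 4) ∞ ηV {p : E4 | p 0 ^ 2 + p 1 ^ 2 < R₁⁻¹ ^ 2} ∧
            Set.InjOn ηV {p : E4 | p 0 ^ 2 + p 1 ^ 2 < R₁⁻¹ ^ 2} ∧
            (∀ p : E4, p 0 ^ 2 + p 1 ^ 2 < R₁⁻¹ ^ 2 → (p 0 ≠ 0 ∨ p 1 ≠ 0) →
              ηV p = ι (χ (WithLp.toLp 2
                ![p 0 / (p 0 ^ 2 + p 1 ^ 2), -(p 1) / (p 0 ^ 2 + p 1 ^ 2), p 2, p 3]))) ∧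
            (∀ p : E4, p 0 = 0 → p 1 = 0 → ηV p ∉ Set.range ι) ∧
            (∀ p : E4, p 0 ^ 2 + p 1 ^ 2 < R₁⁻¹ ^ 2 → ∀ q : E4,
              JX (ηV p) (mfderiv 𝓘(ℝ, E4) (𝓡 4) ηV p q) =
                mfderiv 𝓘(ℝ, E4) (𝓡 4) ηV p (WithLp.toLp 2 ![-(q 1), q 0, -(q 3), q 2]))) ∧
          (IsLocalDiffeomorphOn 𝓘(ℝ, E4) (𝓡 4) ∞ ηH {p : E4 | p 2 ^ 2 + p 3 ^ 2 < R₁⁻¹ ^ 2} ∧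
            Set.InjOn ηH {p : E4 | p 2 ^ 2 + p 3 ^ 2 < R₁⁻¹ ^ 2} ∧
            (∀ p : E4, p 2 ^ 2 + p 3 ^ 2 < R₁⁻¹ ^ 2 → (p 2 ≠ 0 ∨ p 3 ≠ 0) →
              ηH p = ι (χ (WithLp.toLp 2
                ![p 0, p 1, p 2 / (p 2 ^ 2 + p 3 ^ 2), -(p 3) / (p 2 ^ 2 + p 3 ^ 2)]))) ∧
            (∀ p : E4, p 2 = 0 → p 3 = 0 → ηH p ∉ Set.range ι) ∧
            (∀ p : E4, p 2 ^ 2 + p 3 ^ 2 < R₁⁻¹ ^ 2 → ∀ q : E4,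
              JX (ηH p) (mfderiv 𝓘(ℝ, E4) (𝓡 4) ηH p q) =
                mfderiv 𝓘(ℝ, E4) (𝓡 4) ηH p (WithLp.toLp 2 ![-(q 1), q 0, -(q 3), q 2]))) ∧
          (IsLocalDiffeomorphOn 𝓘(ℝ, E4) (𝓡 4) ∞ ηC
              {p : E4 | p 0 ^ 2 + p 1 ^ 2 < R₁⁻¹ ^ 2 ∧ p 2 ^ 2 + p 3 ^ 2 < R₁⁻¹ ^ 2} ∧
            Set.InjOn ηC {p : E4 | p 0 ^ 2 + p 1 ^ 2 < R₁⁻¹ ^ 2 ∧ p 2 ^ 2 + p 3 ^ 2 < R₁⁻¹ ^ 2} ∧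
            (∀ p : E4, p 0 ^ 2 + p 1 ^ 2 < R₁⁻¹ ^ 2 → p 2 ^ 2 + p 3 ^ 2 < R₁⁻¹ ^ 2 →
              (p 2 ≠ 0 ∨ p 3 ≠ 0) →
              ηC p = ηV (WithLp.toLp 2
                ![p 0, p 1, p 2 / (p 2 ^ 2 + p 3 ^ 2), -(p 3) / (p 2 ^ 2 + p 3 ^ 2)])) ∧
            (∀ p : E4, p 0 ^ 2 + p 1 ^ 2 < R₁⁻¹ ^ 2 → p 2 ^ 2 + p 3 ^ 2 < R₁⁻¹ ^ 2 →
              (p 0 ≠ 0 ∨ p 1 ≠ 0) →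
              ηC p = ηH (WithLp.toLp 2
                ![p 0 / (p 0 ^ 2 + p 1 ^ 2), -(p 1) / (p 0 ^ 2 + p 1 ^ 2), p 2, p 3])) ∧
            ηC 0 ∉ Set.range ι ∧
            (∀ p : E4, p 0 ^ 2 + p 1 ^ 2 < R₁⁻¹ ^ 2 → p 2 ^ 2 + p 3 ^ 2 < R₁⁻¹ ^ 2 → ∀ q : E4,
              JX (ηC p) (mfderiv 𝓘(ℝ, E4) (𝓡 4) ηC p q) =
                mfderiv 𝓘(ℝ, E4) (𝓡 4) ηC p (WithLp.toLp 2 ![-(q 1), q 0, -(q 3), q 2]))) ∧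
          (∀ y : X, y ∈ Set.range ι ∨ (∃ p : E4, p 0 ^ 2 + p 1 ^ 2 < R₁⁻¹ ^ 2 ∧ ηV p = y) ∨
            (∃ p : E4, p 2 ^ 2 + p 3 ^ 2 < R₁⁻¹ ^ 2 ∧ ηH p = y) ∨
            (∃ p : E4, (p 0 ^ 2 + p 1 ^ 2 < R₁⁻¹ ^ 2 ∧ p 2 ^ 2 + p 3 ^ 2 < R₁⁻¹ ^ 2) ∧ ηC p = y)) →
          ∃ σ : M ≃ₘ⟮𝓡 4, 𝓡 4⟯ E4,
            (∀ (x : M) (v : TangentSpace (𝓡 4) x) (a b : E4), a = mfderiv (𝓡 4) 𝓘(ℝ, E4) σ x v →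
                b = mfderiv (𝓡 4) 𝓘(ℝ, E4) σ x (J x v) →
                (a 2 = 0 → a 3 = 0 → b 2 = 0 ∧ b 3 = 0) ∧ (a 0 = 0 → a 1 = 0 → b 0 = 0 ∧ b 1 = 0)) ∧
            (∀ (x : M) (v : TangentSpace (𝓡 4) x), v ≠ 0 →
                0 < stdSymplecticForm (mfderiv (𝓡 4) 𝓘(ℝ, E4) σ x v)
                  (mfderiv (𝓡 4) 𝓘(ℝ, E4) σ x (J x v))) ∧
            (∀ w : E4, R₁ ^ 2 < w 0 ^ 2 + w 1 ^ 2 → (σ (χ w)) 0 = w 0 ∧ (σ (χ w)) 1 = w 1) ∧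
            (∀ w : E4, R₁ ^ 2 < w 2 ^ 2 + w 3 ^ 2 → (σ (χ w)) 2 = w 2 ∧ (σ (χ w)) 3 = w 3) ∧
            (∃ g : E4 → E2, ContDiffOn ℝ ∞ g {p : E4 | p 0 ^ 2 + p 1 ^ 2 < R₁⁻¹ ^ 2} ∧
              (∀ p q : E4, p 0 ^ 2 + p 1 ^ 2 < R₁⁻¹ ^ 2 → (p 0 ≠ 0 ∨ p 1 ≠ 0) →
                q = σ (χ (WithLp.toLp 2
                  ![p 0 / (p 0 ^ 2 + p 1 ^ 2), -(p 1) / (p 0 ^ 2 + p 1 ^ 2), p 2, p 3])) →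
                g p = WithLp.toLp 2 ![q 2, q 3]) ∧
              (∀ p : E4, p 0 = 0 → p 1 = 0 → g p = WithLp.toLp 2 ![p 2, p 3])) ∧
            (∃ h : E4 → E2, ContDiffOn ℝ ∞ h {p : E4 | p 2 ^ 2 + p 3 ^ 2 < R₁⁻¹ ^ 2} ∧
              (∀ p q : E4, p 2 ^ 2 + p 3 ^ 2 < R₁⁻¹ ^ 2 → (p 2 ≠ 0 ∨ p 3 ≠ 0) →
                q = σ (χ (WithLp.toLp 2
                  ![p 0, p 1, p 2 / (p 2 ^ 2 + p 3 ^ 2), -(p 3) / (p 2 ^ 2 + p 3 ^ 2)])) →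
                h p = WithLp.toLp 2 ![q 0, q 1]) ∧
              (∀ p : E4, p 2 = 0 → p 3 = 0 → h p = WithLp.toLp 2 ![p 0, p 1]))) →
    gromov_recognitionR4_relEnd :=
  fun hB => GromovRecognitionRelEnd_of_biFoliation hB

/-- **Registered helper sub-goal `helper_cruxCap_iff_literature`** (anchor of this file on item
stmt-SmoothPoincare4-11009: the reduction theorems above exceed the 4000-character limit of
`workitem stub-add`): the route decl concluded by `GromovRecognitionRelEnd_of_biFoliation` IS the
audited Literature named fact, definitionally — so the reduction is a reduction of
`Literature.Geometry.Symplectic.gromov_recognitionR4_relEnd` itself. [cite: McDuffSalamon2017, Rem. 4.5.2 (viii)] -/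
theorem helper_cruxCap_iff_literature :
    (Summit.SmoothPoincare4.SmoothPoincare4.Theses.SymplecticCap.GromovRecognitionRelEnd ↔
      Literature.Geometry.Symplectic.gromov_recognitionR4_relEnd) :=
  Iff.rfl

end Summit.SmoothPoincare4.SmoothPoincare4.Theorems.GromovRecognitionRelEnd.CrossCapLaurent

end
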